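import Summits.ValiantsHypothesis.ValiantsHypothesis.Theses.IntegralGCT
import Literature.Computability.AlgebraicComplexity.OrbitClosureProofs

/-!
# `IntegralGCT.NoIntegralObstructionBarrier` (item `stmt-ValiantsHypothesis-0982`) — formal status

The item is the NEGATIVE SIDE / kill criterion of route `IntegralGCT` of `ValiantsHypothesis`:

  `S := ∃ c₀ n₀, ∀ n ≥ n₀, ∀ m ≥ n^c₀, ∀ d, ∃ φ : ℂ[Δ det_m]_d → ℂ[Δ X₀₀^(m-n) per_n]_d`
  `GL_{m²}`-equivariant with `φ(Λ(det_m, d)) = Λ(pp, d)`,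

where `Λ(f, d)` is the integral lattice (classes of INTEGER degree-`d` forms in the coefficient
coordinates). This file does not settle `S` (no proof of `S` or `¬ S` is known: see the theorems
below and the item's release note); it makes its logical position inside the tree FORMAL:

* `exists_latticeOnto_intertwiner_of_mem_orbitClosure` — the integral obstruction principle for
  general forms `f, g` (if `g ∈ Δ[f]`, restriction of functions is an intertwiner carrying
  `Λ(f, d)` ONTO `Λ(g, d)`); the content of route decl `IntegralPrinciple`, proved.
* `surjective_of_image_intLattice_eq` — an intertwiner carrying `Λ(f, d)` onto `Λ(g, d)` is
  surjective (integer monomials span `ℂ[Δ g]_d`); the content of route decl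
  `IntegralRefinesMultiplicity`, proved.
* `noIntegralObstructionBarrier_of_polyBorder` — UPPER bound: if the padded permanent lies in
  `Δ(det_m)` from some polynomial padding `m ≥ n^c₀` on (failure of the border form of Valiant's
  hypothesis, cofinally), then `S`.
* `not_hasMultiplicityObstruction_of_noIntegralObstructionBarrier` — LOWER bound: `S` implies that
  from some polynomial padding on there is no multiplicity obstruction in ANY degree — the
  multiplicity analogue of Bürgisser–Ikenmeyer–Panova's no-occurrence theorem, recorded as OPEN
  (Bläser–Ikenmeyer 2025 §12.4; route `GCTMult`, decl `GctNoMultBarrier`).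
* `exists_not_mem_orbitClosure_of_not_noIntegralObstructionBarrier` — `¬ S` gives, for EVERY
  exponent `c₀`, infinitely many `n` with some `m ≥ n^c₀` and `X₀₀^(m-n) per_n ∉ Δ(det_m)`:
  an infinitely-often superpolynomial lower bound for the border determinantal complexity of the
  permanent (Valiant–Mulmuley–Sohoni strength).
* `not_integralFlipQP_of_noIntegralObstructionBarrier` — the kill criterion made formal: `S`
  refutes the route's crux `IntegralFlipQP` (the quasi-polynomial window contains `m = n^c₀`).

Sources: Bürgisser–Landsberg–Manivel–Weyman 2011 §2 (surjection template); Bürgisser–Ikenmeyer–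
Panova 2019 §1, Thm 1.1; Mulmuley–Sohoni 2001 §4, 2008. All proofs are elementary bookkeeping over
`Literature.Computability.AlgebraicComplexity.GCTObstructions`.
-/

set_option linter.dupNamespace false -- single-conjunct summit: `ValiantsHypothesis.ValiantsHypothesis`

namespace Summit.ValiantsHypothesis.ValiantsHypothesis.Theorems.IntegralGCTNoIntegralObstructionBarrier

open MvPolynomial Representation
open Literature.Computability.AlgebraicComplexity
open Summit.ValiantsHypothesis.ValiantsHypothesis.Theses.IntegralGCT

/-! ### The two lattice lemmas (general forms `f`, `g`) -/

/-- **Integral obstruction principle.** If `g ∈ Δ[f]` then the restriction of polynomial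
functions `ℂ[Δ[f]]_d → ℂ[Δ[g]]_d` (identity on representatives) is a `GL`-intertwiner carrying
the integral lattice `Λ(f, d)` (classes of integer degree-`d` forms) ONTO `Λ(g, d)`. This is the
content of the route decl `IntegralPrinciple` (Bürgisser–Landsberg–Manivel–Weyman 2011 §2, over
`ℤ`). [folklore] -/
theorem exists_latticeOnto_intertwiner_of_mem_orbitClosure {σ : Type} [Fintype σ] [DecidableEq σ]
    (f g : MvPolynomial σ ℂ) (m d : ℕ) (h : g ∈ orbitClosure f) :
    ∃ φ : IntertwiningMap (orbitCoordRepDeg f m d) (orbitCoordRepDeg g m d),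
      (fun x => ((φ x : orbitCoordRingDeg g m d) : OrbitCoordRing g m)) ''
          {x | ∃ F : MvPolynomial (DegIdx σ m) ℤ, F.IsHomogeneous d ∧
            Ideal.Quotient.mk (orbitVanishingIdeal f m) (MvPolynomial.map (Int.castRingHom ℂ) F) =
              (x : OrbitCoordRing f m)} =
        {y | ∃ F : MvPolynomial (DegIdx σ m) ℤ, F.IsHomogeneous d ∧
          Ideal.Quotient.mk (orbitVanishingIdeal g m) (MvPolynomial.map (Int.castRingHom ℂ) F) =
            y} := by
  let ψ : orbitCoordRingDeg f m d →ₗ[ℂ] orbitCoordRingDeg g m d :=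
    (orbitCoordRestrict m h).toLinearMap.restrict fun x hx => orbitCoordRestrict_mem m d h hx
  let φ : IntertwiningMap (orbitCoordRepDeg f m d) (orbitCoordRepDeg g m d) :=
    ⟨ψ, fun A => by
      apply LinearMap.ext
      intro x
      apply Subtype.ext
      obtain ⟨F, hF⟩ := Ideal.Quotient.mk_surjective (x : OrbitCoordRing f m)
      simp only [ψ, LinearMap.coe_comp, Function.comp_apply, LinearMap.restrict_apply,
        orbitCoordRepDeg_apply_coe, orbitCoordRep_apply, AlgHom.toLinearMap_apply, ← hF,
        orbitCoordSubst_mk, orbitCoordRestrict_mk]⟩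
  have hφ : ∀ x : orbitCoordRingDeg f m d,
      ((φ x : orbitCoordRingDeg g m d) : OrbitCoordRing g m) =
        orbitCoordRestrict m h (x : OrbitCoordRing f m) := fun _ => rfl
  refine ⟨φ, ?_⟩
  ext y
  simp only [Set.mem_image, Set.mem_setOf_eq, hφ]
  constructor
  · rintro ⟨x, ⟨F, hF, hFx⟩, rfl⟩
    exact ⟨F, hF, by rw [← hFx, orbitCoordRestrict_mk]⟩
  · rintro ⟨F, hF, rfl⟩
    exact ⟨⟨Ideal.Quotient.mk _ (MvPolynomial.map (Int.castRingHom ℂ) F),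
      mem_orbitCoordRingDeg_iff.2 ⟨_, hF.map _, rfl⟩⟩, ⟨F, hF, rfl⟩, rfl⟩

/-- **Lattice-onto-lattice forces surjectivity.** An intertwiner `φ : ℂ[Δ[f]]_d → ℂ[Δ[g]]_d`
carrying `Λ(f, d)` onto `Λ(g, d)` is surjective: every complex degree-`d` form is a `ℂ`-linear
combination of (integer) monomials, whose classes lie in `Λ(g, d) ⊆ range φ`. This is the content
of the route decl `IntegralRefinesMultiplicity` (so an integral obstruction is implied by a
multiplicity obstruction). [folklore] -/
theorem surjective_of_image_intLattice_eq {σ : Type} [Fintype σ] [DecidableEq σ]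
    (f g : MvPolynomial σ ℂ) (m d : ℕ)
    (φ : IntertwiningMap (orbitCoordRepDeg f m d) (orbitCoordRepDeg g m d))
    (hφ : (fun x => ((φ x : orbitCoordRingDeg g m d) : OrbitCoordRing g m)) ''
          {x | ∃ F : MvPolynomial (DegIdx σ m) ℤ, F.IsHomogeneous d ∧
            Ideal.Quotient.mk (orbitVanishingIdeal f m) (MvPolynomial.map (Int.castRingHom ℂ) F) =
              (x : OrbitCoordRing f m)} =
        {y | ∃ F : MvPolynomial (DegIdx σ m) ℤ, F.IsHomogeneous d ∧
          Ideal.Quotient.mk (orbitVanishingIdeal g m) (MvPolynomial.map (Int.castRingHom ℂ) F) =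
            y}) :
    Function.Surjective φ := by
  -- `T`: the range of `φ`, viewed inside the whole coordinate ring `ℂ[Δ[g]]`.
  let T : Submodule ℂ (OrbitCoordRing g m) :=
    (LinearMap.range φ.toLinearMap).map (orbitCoordRingDeg g m d).subtype
  -- classes of integer degree-`d` forms lie in `T` (they form the lattice `Λ(g, d) = φ(Λ(f, d))`)
  have hlat : ∀ F : MvPolynomial (DegIdx σ m) ℤ, F.IsHomogeneous d →
      Ideal.Quotient.mk (orbitVanishingIdeal g m) (MvPolynomial.map (Int.castRingHom ℂ) F) ∈ T := by
    intro F hF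
    have hmem : Ideal.Quotient.mk (orbitVanishingIdeal g m) (MvPolynomial.map (Int.castRingHom ℂ) F) ∈
        (fun x => ((φ x : orbitCoordRingDeg g m d) : OrbitCoordRing g m)) ''
          {x | ∃ F : MvPolynomial (DegIdx σ m) ℤ, F.IsHomogeneous d ∧
            Ideal.Quotient.mk (orbitVanishingIdeal f m) (MvPolynomial.map (Int.castRingHom ℂ) F) =
              (x : OrbitCoordRing f m)} := by
      rw [hφ]
      exact ⟨F, hF, rfl⟩
    obtain ⟨x, -, hx⟩ := hmem
    exact ⟨φ x, LinearMap.mem_range_self _ x, hx⟩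
  -- in particular the classes of the degree-`d` monomials lie in `T`
  have hmono : ∀ e : DegIdx σ m →₀ ℕ, e.degree = d →
      Ideal.Quotient.mk (orbitVanishingIdeal g m) (monomial e (1 : ℂ)) ∈ T := by
    intro e he
    have := hlat (monomial e (1 : ℤ)) (isHomogeneous_monomial _ he)
    rwa [map_monomial, map_one] at this
  -- scalars pass through the quotient map
  have hsmul : ∀ (c : ℂ) (q : MvPolynomial (DegIdx σ m) ℂ),
      Ideal.Quotient.mk (orbitVanishingIdeal g m) (c • q) =
        c • Ideal.Quotient.mk (orbitVanishingIdeal g m) q :=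
    fun c q => map_smul (Ideal.Quotient.mkₐ ℂ (orbitVanishingIdeal g m)) c q
  -- hence the class of every complex degree-`d` form lies in `T`
  have hall : ∀ F : MvPolynomial (DegIdx σ m) ℂ, F.IsHomogeneous d →
      Ideal.Quotient.mk (orbitVanishingIdeal g m) F ∈ T := by
    intro F hF
    rw [← support_sum_monomial_coeff F, map_sum]
    refine Submodule.sum_mem _ fun e he => ?_
    have hdeg : e.degree = d := by
      rw [Finsupp.degree_eq_weight_one]
      exact hF (mem_support_iff.mp he)
    have hmon : (monomial e (coeff e F) : MvPolynomial (DegIdx σ m) ℂ) = coeff e F • monomial e 1 := by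
      rw [smul_monomial, smul_eq_mul, mul_one]
    rw [hmon, hsmul]
    exact Submodule.smul_mem _ _ (hmono e hdeg)
  intro y
  obtain ⟨F, hF, hFy⟩ := mem_orbitCoordRingDeg_iff.1 y.2
  have hy : (y : OrbitCoordRing g m) ∈ T := hFy ▸ hall F hF
  obtain ⟨z, hz, hzy⟩ := Submodule.mem_map.1 hy
  obtain ⟨x, rfl⟩ := LinearMap.mem_range.1 hz
  exact ⟨x, Subtype.ext hzy⟩

/-! ### Where `NoIntegralObstructionBarrier` sits -/

/-- UPPER bound. If the padded permanent `X₀₀^(m-n) per_n` lies in `Δ(det_m)` from some polynomial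
padding `m ≥ n^c₀` on (for all large `n`), then there is no integral obstruction there at all:
`NoIntegralObstructionBarrier` holds, by the integral obstruction principle. So `S` follows from
the (cofinal) failure of the border form of Valiant's hypothesis. [folklore] -/
theorem noIntegralObstructionBarrier_of_polyBorder
    (h : ∃ c₀ n₀ : ℕ, ∀ n ≥ n₀, ∀ (m : ℕ) [NeZero m], n ^ c₀ ≤ m →
      paddedPerPoly ℂ n m ∈ orbitClosure (detPoly (Fin m) ℂ)) :
    NoIntegralObstructionBarrier := by
  obtain ⟨c₀, n₀, h⟩ := h
  exact ⟨c₀, n₀, fun n hn m _ hm d =>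
    exists_latticeOnto_intertwiner_of_mem_orbitClosure _ _ m d (h n hn m hm)⟩

/-- LOWER bound. `NoIntegralObstructionBarrier` implies that from some polynomial padding
`m ≥ n^c₀` on there is NO multiplicity obstruction (no degree `d` without an equivariant surjection
`ℂ[Δ det_m]_d ↠ ℂ[Δ X₀₀^(m-n) per_n]_d`) — the multiplicity analogue of the no-occurrence theorem of
Bürgisser–Ikenmeyer–Panova 2019 (Thm 1.1), which is OPEN (Bläser–Ikenmeyer 2025 §12.4; route
`GCTMult`, decl `GctNoMultBarrier`). [folklore] -/
theorem not_hasMultiplicityObstruction_of_noIntegralObstructionBarrier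
    (h : NoIntegralObstructionBarrier) :
    ∃ c₀ n₀ : ℕ, ∀ n ≥ n₀, ∀ (m : ℕ) [NeZero m], n ^ c₀ ≤ m → ∀ d : ℕ,
      ¬ HasMultiplicityObstruction (detPoly (Fin m) ℂ) (paddedPerPoly ℂ n m) m d := by
  obtain ⟨c₀, n₀, h⟩ := h
  refine ⟨c₀, n₀, fun n hn m _ hm d hobs => ?_⟩
  obtain ⟨φ, hφ⟩ := h n hn m hm d
  exact hobs ⟨φ, surjective_of_image_intLattice_eq _ _ m d φ hφ⟩

/-- REFUTING the barrier is Valiant–Mulmuley–Sohoni-hard: `¬ NoIntegralObstructionBarrier` gives,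
for EVERY exponent `c₀` and beyond every `n₀`, some `n` and some padding `m ≥ n^c₀` with
`X₀₀^(m-n) per_n ∉ Δ(det_m)` — an infinitely-often superpolynomial lower bound on the border
determinantal complexity of the permanent. [folklore] -/
theorem exists_not_mem_orbitClosure_of_not_noIntegralObstructionBarrier
    (h : ¬ NoIntegralObstructionBarrier) (c₀ n₀ : ℕ) :
    ∃ n ≥ n₀, ∃ (m : ℕ) (_ : NeZero m), n ^ c₀ ≤ m ∧
      paddedPerPoly ℂ n m ∉ orbitClosure (detPoly (Fin m) ℂ) := by
  by_contra hcon
  push Not at hcon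
  exact h (noIntegralObstructionBarrier_of_polyBorder
    ⟨c₀, n₀, fun n hn m inst hm => hcon n hn m inst hm⟩)

/-! ### The kill criterion: `S` refutes the crux `IntegralFlipQP` -/

/-- Window arithmetic: a polynomial padding `n^e` (`e ≥ 1`) lies in the quasi-polynomial window
with parameter `e + 1`: `n ^ e ≤ 2 ^ ((log₂ n + (e + 1)) ^ (e + 1))`
(from `n < 2^(log₂ n + 1)` and `(L + 1)·e ≤ (L + e + 1)²`). [folklore] -/
theorem pow_le_two_pow_log_add_pow (n e : ℕ) (he : 1 ≤ e) :
    n ^ e ≤ 2 ^ ((Nat.log 2 n + (e + 1)) ^ (e + 1)) := by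
  have h1 : n ^ e ≤ (2 ^ (Nat.log 2 n + 1)) ^ e :=
    Nat.pow_le_pow_left (Nat.lt_pow_succ_log_self Nat.one_lt_two n).le e
  have key : (Nat.log 2 n + 1) * e ≤ (Nat.log 2 n + (e + 1)) ^ (e + 1) :=
    calc (Nat.log 2 n + 1) * e
        ≤ (Nat.log 2 n + (e + 1)) * (Nat.log 2 n + (e + 1)) := Nat.mul_le_mul (by omega) (by omega)
      _ = (Nat.log 2 n + (e + 1)) ^ 2 := (Nat.pow_two _).symm
      _ ≤ (Nat.log 2 n + (e + 1)) ^ (e + 1) := Nat.pow_le_pow_right (by omega) (by omega)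
  calc n ^ e ≤ (2 ^ (Nat.log 2 n + 1)) ^ e := h1
    _ = 2 ^ ((Nat.log 2 n + 1) * e) := (Nat.pow_mul 2 _ e).symm
    _ ≤ 2 ^ ((Nat.log 2 n + (e + 1)) ^ (e + 1)) := Nat.pow_le_pow_right (by omega) key

/-- **Kill criterion made formal.** `NoIntegralObstructionBarrier` refutes the route's crux
`IntegralFlipQP`: for `c := max c₀ 1 + 1` the quasi-polynomial window of `IntegralFlipQP c`
contains the padding `m = n^(max c₀ 1) ≥ n^c₀`, where the barrier supplies a lattice-preserving
intertwiner in every degree. [folklore] -/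
theorem not_integralFlipQP_of_noIntegralObstructionBarrier (h : NoIntegralObstructionBarrier) :
    ¬ IntegralFlipQP := by
  intro hflip
  obtain ⟨c₀, n₀, hbar⟩ := h
  obtain ⟨n₁, hn₁⟩ := hflip (max c₀ 1 + 1)
  set e := max c₀ 1 with he
  set n := max (max n₀ n₁) 1 with hn
  have he1 : 1 ≤ e := le_max_right _ _
  have hn0 : n₀ ≤ n := (le_max_left _ _).trans (le_max_left _ _)
  have hn1 : n₁ ≤ n := (le_max_right _ _).trans (le_max_left _ _)
  have hnpos : 1 ≤ n := le_max_right _ _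
  haveI : NeZero (n ^ e) := ⟨(Nat.pow_pos hnpos).ne'⟩
  have hnm : n ≤ n ^ e := Nat.le_self_pow (by omega) n
  have hwin : n ^ e ≤ 2 ^ ((Nat.log 2 n + (e + 1)) ^ (e + 1)) :=
    pow_le_two_pow_log_add_pow n e he1
  obtain ⟨d, hd⟩ := hn₁ n hn1 (n ^ e) hnm hwin
  exact hd (hbar n hn0 (n ^ e) (Nat.pow_le_pow_right hnpos (le_max_left _ _)) d)

/-- Contrapositive form: the route's crux `IntegralFlipQP` refutes `NoIntegralObstructionBarrier`.
[folklore] -/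
theorem not_noIntegralObstructionBarrier_of_integralFlipQP (h : IntegralFlipQP) :
    ¬ NoIntegralObstructionBarrier :=
  fun hbar => not_integralFlipQP_of_noIntegralObstructionBarrier hbar h

/-! ### Appendix: the pointwise barrier holds — only the uniformity `m ≥ n^c₀` is open -/

/-- Beyond the determinantal complexity there is no integral obstruction: if `dc(per_n) ≤ m` and
`n ≤ m` then `X₀₀^(m-n) per_n ∈ Δ(det_m)` (Valiant universality padded, `HasDetRepr.mono_holds`,
and Mulmuley–Sohoni 2001 Prop. 4.4, `paddedPerPoly_mem_orbitClosure_detPoly_of_hasDetRepr_holds`),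
so the restriction intertwiner carries `Λ(det_m, d)` onto `Λ(pp, d)` in every degree `d`.
[folklore] -/
theorem exists_latticeOnto_intertwiner_of_determinantalComplexity_le (n m : ℕ) [NeZero m]
    (hdc : determinantalComplexity (perPoly (Fin n) ℂ) ≤ m) (hnm : n ≤ m) (d : ℕ) :
    ∃ φ : IntertwiningMap (orbitCoordRepDeg (detPoly (Fin m) ℂ) m d)
        (orbitCoordRepDeg (paddedPerPoly ℂ n m) m d),
      (fun x => ((φ x : orbitCoordRingDeg (paddedPerPoly ℂ n m) m d) :
          OrbitCoordRing (paddedPerPoly ℂ n m) m)) ''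
          {x | ∃ F : MvPolynomial (DegIdx (Fin m × Fin m) m) ℤ, F.IsHomogeneous d ∧
            Ideal.Quotient.mk (orbitVanishingIdeal (detPoly (Fin m) ℂ) m)
              (MvPolynomial.map (Int.castRingHom ℂ) F) = (x : OrbitCoordRing (detPoly (Fin m) ℂ) m)} =
        {y | ∃ F : MvPolynomial (DegIdx (Fin m × Fin m) m) ℤ, F.IsHomogeneous d ∧
          Ideal.Quotient.mk (orbitVanishingIdeal (paddedPerPoly ℂ n m) m)
            (MvPolynomial.map (Int.castRingHom ℂ) F) = y} :=
  exists_latticeOnto_intertwiner_of_mem_orbitClosure _ _ m d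
    (paddedPerPoly_mem_orbitClosure_detPoly_of_hasDetRepr_holds
      (HasDetRepr.mono_holds (hasDetRepr_determinantalComplexity_holds _) hdc) hnm)

/-- **The pointwise barrier holds.** For every `n` there is a padding threshold
(`max (dc per_n) n`) beyond which NO integral obstruction exists in any degree. Hence the entire
content of `NoIntegralObstructionBarrier` is the UNIFORMITY of the threshold (`≤ n^c₀`): the item
is a statement about the growth of the least obstruction-free padding, sandwiched between
`dc`/border-`dc` of the permanent being polynomial (sufficient) and the absence of multiplicity
obstructions from polynomial padding on (necessary). [folklore] -/
theorem exists_threshold_latticeOnto (n : ℕ) :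
    ∃ m₁ : ℕ, ∀ (m : ℕ) [NeZero m], m₁ ≤ m → ∀ d : ℕ,
      ∃ φ : IntertwiningMap (orbitCoordRepDeg (detPoly (Fin m) ℂ) m d)
          (orbitCoordRepDeg (paddedPerPoly ℂ n m) m d),
        (fun x => ((φ x : orbitCoordRingDeg (paddedPerPoly ℂ n m) m d) :
            OrbitCoordRing (paddedPerPoly ℂ n m) m)) ''
            {x | ∃ F : MvPolynomial (DegIdx (Fin m × Fin m) m) ℤ, F.IsHomogeneous d ∧
              Ideal.Quotient.mk (orbitVanishingIdeal (detPoly (Fin m) ℂ) m)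
                (MvPolynomial.map (Int.castRingHom ℂ) F) =
                  (x : OrbitCoordRing (detPoly (Fin m) ℂ) m)} =
          {y | ∃ F : MvPolynomial (DegIdx (Fin m × Fin m) m) ℤ, F.IsHomogeneous d ∧
            Ideal.Quotient.mk (orbitVanishingIdeal (paddedPerPoly ℂ n m) m)
              (MvPolynomial.map (Int.castRingHom ℂ) F) = y} :=
  ⟨max (determinantalComplexity (perPoly (Fin n) ℂ)) n, fun m _ hm d =>
    exists_latticeOnto_intertwiner_of_determinantalComplexity_le n m
      ((le_max_left _ _).trans hm) ((le_max_right _ _).trans hm) d⟩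

/-- `VNP ⊆ VBP`-type hypotheses give the barrier: if the determinantal complexity of the permanent
is polynomially bounded from some `n₀` on, then `NoIntegralObstructionBarrier` holds (with
exponent `max c₀ 1`). [folklore] -/
theorem noIntegralObstructionBarrier_of_determinantalComplexity_le_pow
    (h : ∃ c₀ n₀ : ℕ, ∀ n ≥ n₀, determinantalComplexity (perPoly (Fin n) ℂ) ≤ n ^ c₀) :
    NoIntegralObstructionBarrier := by
  obtain ⟨c₀, n₀, h⟩ := h
  refine ⟨max c₀ 1, max n₀ 1, fun n hn m _ hm d => ?_⟩
  have hn₀ : n₀ ≤ n := (le_max_left _ _).trans hn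
  have hn1 : 1 ≤ n := (le_max_right _ _).trans hn
  have hpow : n ^ c₀ ≤ n ^ max c₀ 1 := Nat.pow_le_pow_right hn1 (le_max_left _ _)
  have hnm : n ≤ m := (Nat.le_self_pow (by omega) n).trans hm
  exact exists_latticeOnto_intertwiner_of_determinantalComplexity_le n m
    (((h n hn₀).trans hpow).trans hm) hnm d

/-! ### Appendix 2: the barrier also kills the multiplicity crux of route `GCTMult` -/

/-- `NoIntegralObstructionBarrier` refutes the multiplicity-obstruction crux of route `GCTMult` as
well (decl `GCTMult.GctMultObstructions`, spelled out by value — also the hypothesis of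
`GCTMult.GctObstructionsToThesis`): in the quasi-polynomial window with parameter
`max c₀ 1 + 1` the padding `m = n^(max c₀ 1)` carries, by the barrier and
`surjective_of_image_intLattice_eq`, an equivariant SURJECTION in every degree, so no degree has a
multiplicity obstruction there. [folklore] -/
theorem not_multObstructionsQP_of_noIntegralObstructionBarrier (h : NoIntegralObstructionBarrier) :
    ¬ (∀ c : ℕ, ∃ n₀ : ℕ, ∀ n ≥ n₀, ∀ (m : ℕ) [NeZero m], n ≤ m → m ≤ 2 ^ ((Nat.log 2 n + c) ^ c) →
      ∃ d : ℕ, HasMultiplicityObstruction (detPoly (Fin m) ℂ) (paddedPerPoly ℂ n m) m d) := by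
  intro hmult
  obtain ⟨c₀, n₀, hbar⟩ := not_hasMultiplicityObstruction_of_noIntegralObstructionBarrier h
  obtain ⟨n₁, hn₁⟩ := hmult (max c₀ 1 + 1)
  set e := max c₀ 1 with he
  set n := max (max n₀ n₁) 1 with hn
  have he1 : 1 ≤ e := le_max_right _ _
  have hn0 : n₀ ≤ n := (le_max_left _ _).trans (le_max_left _ _)
  have hn1 : n₁ ≤ n := (le_max_right _ _).trans (le_max_left _ _)
  have hnpos : 1 ≤ n := le_max_right _ _
  haveI : NeZero (n ^ e) := ⟨(Nat.pow_pos hnpos).ne'⟩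
  have hnm : n ≤ n ^ e := Nat.le_self_pow (by omega) n
  have hwin : n ^ e ≤ 2 ^ ((Nat.log 2 n + (e + 1)) ^ (e + 1)) :=
    pow_le_two_pow_log_add_pow n e he1
  obtain ⟨d, hd⟩ := hn₁ n hn1 (n ^ e) hnm hwin
  exact hbar n hn0 (n ^ e) (Nat.pow_le_pow_right hnpos (le_max_left _ _)) d hd

end Summit.ValiantsHypothesis.ValiantsHypothesis.Theorems.IntegralGCTNoIntegralObstructionBarrier
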